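import Summits.HodgeConjecture.HodgeConjecture.Theorems.K2E3LocalUnitaryWittDefs   -- part 1∕2: `WittIndex`, `wittForm`, `wittFormOn` (+ entry lemmas), cocharacters, levels
import Summits.HodgeConjecture.HodgeConjecture.Theorems.K2E3UnitaryParabolicLeviPart  -- ★ K2E3-p10 (D₂): `le_normalizer_parabolic_unitary`, `isComplement'_levi_unipotent_unitary`
import Literature.NumberTheory.Automorphic.ParabolicGL                              -- ★ `standardParabolicGL` ∕ `standardLeviGL` ∕ `unipotentRadicalGL` ∕ `parabolicTripleGL`
import HarnessLib

/-!
# K2 ∕ E3 «EllipticInputs», 13a road A — DEFS LEAF D₁ (part 2∕2) `K2E3LocalUnitaryWittParabolicDefs`: simple roots, breaks, the block labelling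
# `wittBlock S` (ANTI-BLOCK for the Witt form and `Fin.rev`), the standard parabolics `P_S ∕ M_S ∕ N_S ∕ N_S⁻ ≤ U(σ, J)` and the ★ `ParabolicTriple`
# `standardParabolicTriple σ e Han S` of `U(σ, W(r, Han))` (assembled over ★ K2E3-p10 `K2E3UnitaryParabolicLeviPart`; part 1∕2 = ★ `K2E3LocalUnitaryWittDefs`)

Cell `hodgecm-mathlib` (Track B «K2-LIT»), item h413 = `stmt-HodgeConjecture-24833`, line `K2_E3_EllipticInputs`, socket U12-g ∕ 13a (`sig_K2E3LocalIrrepAdmissible`,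
road A = Jacquet's admissibility theorem for `U_N(H)(L⁺_v)`).  Author K2-defs1 (g2) (Track B defs pen) on the DOCKING SPEC of K2E3-p13 (g0)
`MEMO-13a-admissibility-generalN` §5 «D» and the CONVENTION fixed by K2E3-p10 (g2) (K2/STATUS 2026-09-03T23:15:49Z); count-neutral; `--supports … --as helper`.
DEFINITIONS WITH BODIES + `rfl`∕entry lemmas + ONE small membership theorem (the Witt cocharacter is unitary); no `sorry`, no named fact, no `instance`, no
`notation`.  The THEOREM content of `standardParabolicTriple` (the proof fields `le_normalizer` ∕ `isComplement'` of ★ `ParabolicTriple` = the Levi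
decomposition `P_S ∩ U = (M_S ∩ U) ⋉ (N_S ∩ U)` INSIDE `U`) is ★ K2E3-p10's `K2E3UnitaryParabolicLeviPart` (D₂); §3 below only ASSEMBLES it with `τ = Fin.rev`.
NOT here: `leviTriple S S′` (the parabolic `P_S ∩ M_{S′}` of the Levi, `S ⊆ S′`; needs the labelling-refinement lemma) and `S ⊆ S′ ⇒ P_S ≤ P_{S′}`.

CONVENTION (K2E3-p10; typed in part 1∕2 ★ `K2E3LocalUnitaryWittDefs`, same namespace).  Witt index `r`, anisotropic kernel of size `m`, `N = 2r + m`; `WittIndex r m := Fin r ⊕ (Fin m ⊕ Fin r)` read as the ordered basis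
`(e₁, …, e_r ∣ u₁, …, u_m ∣ f_r, …, f₁)` — the `f`-slots REVERSED (slot `j` holds `f_{rev j}`), so `e_i` pairs with the slot `rev i`.  Pairing block `wittPairing R r =
(δ_{i, rev j})`; **Witt normal form** `wittForm r Han = fromBlocks 0 (fromCols 0 (wittPairing R r)) (fromRows 0 (wittPairing R r)) (fromBlocks Han 0 0 0)`
(`h(e_i, f_i) = 1`, `Han` on the `u`-block, `0` elsewhere); on a carrier `n` along `e : WittIndex r m ≃ n`: `wittFormOn e Han := reindex e e (wittForm r Han)`.  In
this order every standard parabolic is BLOCK-UPPER-TRIANGULAR (a pull-back of ★ `standardParabolicGL`), and `r = ⌊N∕2⌋`, `Han = (1)` reproduces Mok's `Φ_N`.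
★ `K2E3HermitianWittBasis.exists_GL_formCongr_eq_wittMatrix_rev` (K2E3-p10) gives, for every non-degenerate hermitian `J` over a field with involution and
`2 ≠ 0`, data `(r, m, e, T, Han)` with `formCongr σ T J = wittFormOn e Han` — by `rfl` on the right-hand side (`wittForm_eq`).

SIMPLE ROOTS AND STANDARD PARABOLICS (this file).  Simple roots are indexed by `Fin r` (`α` ↔ the breakpoint after `e_{α+1}`; `α = r − 1` is the last root, through
`e_r` and the middle block).  `S : Finset (Fin r)` = the simple roots CONTAINED IN the Levi `M_S`; `P_S` stabilises the flag members `V_k = ⟨e₁, …, e_k⟩` at the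
BREAKS `k − 1 ∉ S` (and their orthogonals): `S ⊆ S′ ⇒ P_S ≤ P_{S′}`, `S = univ` gives `U` (`wittParabolic_univ`), `S = ∅` the minimal parabolic (Levi
`(R^×)^r × U(Han)`).  The labelling `wittBlock S : WittIndex r m → Fin (2L+1)` (`L = #{α ∉ S}`; ANTI-BLOCK: `W_{xy} ≠ 0 ⇒ label y = rev (label x)`, the docking hypothesis of ★ `K2E3UnitaryParabolicLeviPart`) counts breaks (`e_{i+1} ↦ #{α ∉ S | α < i}`, middle `↦ #{α ∉ S}`, `f`-slot
`j ↦ #{α ∉ S} + #{α ∉ S | rev α ≤ j}`); `P_S ∕ M_S ∕ N_S ∕ N_S⁻ ≤ U = unitaryGroupOfForm σ J` are the pull-backs of ★ `standardParabolicGL ∕ standardLeviGL ∕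
unipotentRadicalGL` for `wittBlock S ∘ e.symm` (order-dual for `N_S⁻`), for ANY `J : Matrix n n R` — the parabolics of `U` when `J = wittFormOn e Han`.

WITT COCHARACTERS (part 1∕2).  `wittCoweight σ α ϖ : WittIndex r m → Rˣ` (`α : Fin r`, `ϖ : Rˣ`) is `ϖ` on `e₁…e_{α+1}`, `(σ ϖ)⁻¹` on the matching `f₁…f_{α+1}`, `1`
elsewhere; `wittCocharacterGL σ e α ϖ := glDiagonal N R (wittCoweight σ α ϖ ∘ e.symm)` and, for an INVOLUTION `σ`, `wittCocharacter σ hσ e Han α ϖ :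
↥(unitaryGroupOfForm σ (wittFormOn e Han))` (membership `wittCocharacterGL_mem`).  They are diagonal, hence commute; `∏_α a_α(ϖ)^{n_α}` is the dominant cone of
the Cartan decomposition `U = K₀ A⁺ K₀ Z` (socket J6), and `a_α(ϖ)` contracts the radical of the maximal parabolic `P_{univ.erase α}` (socket J7).

INTEGRAL LEVEL (part 1∕2).  Over a valued field `F` (Mathlib `ValuativeRel`): `levelU σ J γ := U ∩ congruenceGL N γ` (names the def-free pattern `(congruenceGL N γ).comap
(unitaryGroupOfForm σ J).subtype` of ★ `UnitaryGroupRayJacquetCriterionAnyRank`) and `maximalCompact σ J := levelU σ J 1 = U ∩ GL_N(𝒪)` (the `K₀` of J6∕J7).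

HONEST LABEL: HC_CM is proved only modulo the 7 printed citations (2 remaining named inputs: hLiu418 = stmt-HodgeConjecture-24832, h413 =
stmt-HodgeConjecture-24833) until rung 0 closes; this file is count-neutral (definitions only).

## References
* [Dieudonne1971GroupesClassiques] J. Dieudonné, *La géométrie des groupes classiques*, 3e éd. (1971), Chap. I §11 (Witt decomposition of hermitian forms).
* [Borel1991] A. Borel, *Linear Algebraic Groups*, 2nd ed. (1991), §23 (relative root systems, standard parabolics; unitary groups as examples).
* [BernsteinZelevinsky1977] I. N. Bernstein, A. V. Zelevinsky, Ann. Sci. ÉNS 10 (1977), §2.1 (standard parabolics `P = M ⋉ U` of `GL_n` by blocks).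
* [Rogawski1990] J. Rogawski, *Automorphic Representations of Unitary Groups in Three Variables* (1990), §1.10 p. 9 (Borel, torus, radical of `U(3)`).
* [Casselman1995] W. Casselman, *Introduction to the theory of admissible representations of p-adic reductive groups* (1995 notes), §1.4 (congruence subgroups `GL_n(𝒪)`, `K_m`).
-/

set_option autoImplicit false
-- the mandated namespace repeats `HodgeConjecture.HodgeConjecture`, as in every `Theorems/*.lean` of this sub-problem
set_option linter.dupNamespace false

namespace Summit.HodgeConjecture.HodgeConjecture.Cruxes.H413.K2E3LocalUnitaryWitt

open Literature.NumberTheory.Automorphic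
open scoped Matrix MatrixGroups

/-! ## §1 Simple roots `Fin r`, breaks, and the block labelling of a standard parabolic -/

section Blocks

variable {r m : ℕ}

/-- The block labelling of `P_S` in natural numbers: label of `e_{i+1}` = number of breaks `α ∉ S` with `α < i`; label of the middle block = number of
all breaks; label of the `f`-slot `j` = (all breaks) + number of breaks `α ∉ S` with `rev α ≤ j` (mirror of the `e`-side).  Constant on each block of `P_S`,
strictly increasing across its breakpoints. [cite: Borel1991, §23] -/
def wittBlockNat (S : Finset (Fin r)) : WittIndex r m → ℕ
  | Sum.inl i => ((Finset.univ \ S).filter fun α => α.val < i.val).card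
  | Sum.inr (Sum.inl _) => (Finset.univ \ S).card
  | Sum.inr (Sum.inr j) => (Finset.univ \ S).card + ((Finset.univ \ S).filter fun α => (Fin.rev α).val ≤ j.val).card

/-- Every label is `≤ 2L`, `L = #{α ∉ S}` the number of breaks (at most `L` breaks on each side). [cite: Borel1991, §23] -/
theorem wittBlockNat_le (S : Finset (Fin r)) (x : WittIndex r m) : wittBlockNat S x ≤ 2 * (Finset.univ \ S).card := by
  rcases x with i | u | j
  · exact (Finset.card_filter_le _ _).trans (by omega)
  · change (Finset.univ \ S).card ≤ _
    omega
  · have h2 := Finset.card_filter_le (Finset.univ \ S) fun α => (Fin.rev α).val ≤ j.val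
    change (Finset.univ \ S).card + _ ≤ _
    omega

/-- `S = univ` (every simple root in the Levi): NO breaks, every label is `0` — one block, `P_univ = U`. [cite: Borel1991, §23] -/
@[simp] theorem wittBlockNat_univ (x : WittIndex r m) : wittBlockNat (Finset.univ : Finset (Fin r)) x = 0 := by
  rcases x with i | u | j <;> simp [wittBlockNat]

/-- **The labels of a hyperbolic pair are mirror images**: if `W(r, Han)_{xy} ≠ 0` then `label(x) + label(y) = 2L` (`L = #{α ∉ S}`): for `x = e_i`,
`y` = its partner slot the breaks `α < i` and `α ≥ i` partition the `L` breaks; on the middle block `L + L`. [cite: Borel1991, §23] -/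
theorem wittBlockNat_add_eq_of_wittForm_ne_zero {R : Type*} [Zero R] [One R] (S : Finset (Fin r)) (Han : Matrix (Fin m) (Fin m) R)
    {x y : WittIndex r m} (hxy : wittForm r Han x y ≠ 0) : wittBlockNat S x + wittBlockNat S y = 2 * (Finset.univ \ S).card := by
  -- the complementary count: `#{α ∉ S | α < i} + #{α ∉ S | rev α ≤ rev i} = L`
  have hcompl : ∀ i : Fin r, ((Finset.univ \ S).filter fun α => α.val < i.val).card +
      ((Finset.univ \ S).filter fun α => (Fin.rev α).val ≤ (Fin.rev i).val).card = (Finset.univ \ S).card := fun i => by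
    have h := Finset.card_filter_add_card_filter_not (s := Finset.univ \ S) (fun α : Fin r => α.val < i.val)
    rw [← h]
    congr 2
    refine Finset.filter_congr fun α _ => ?_
    rw [Fin.val_rev, Fin.val_rev, not_lt]
    omega
  rcases x with i | u | j <;> rcases y with i' | u' | j'
  · exact absurd (wittForm_inl_inl r Han i i') hxy
  · exact absurd (wittForm_inl_inr_inl r Han i u') hxy
  · rw [wittForm_inl_inr_inr] at hxy
    have hi : i = Fin.rev j' := by by_contra h; exact hxy (if_neg h)
    subst hi
    change ((Finset.univ \ S).filter fun α => α.val < (Fin.rev j').val).card +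
      ((Finset.univ \ S).card + ((Finset.univ \ S).filter fun α => (Fin.rev α).val ≤ j'.val).card) = _
    have h := hcompl (Fin.rev j')
    rw [Fin.rev_rev] at h
    omega
  · exact absurd (wittForm_inr_inl_inl r Han u i') hxy
  · change (Finset.univ \ S).card + (Finset.univ \ S).card = _
    omega
  · exact absurd (wittForm_inr_inl_inr_inr r Han u j') hxy
  · rw [wittForm_inr_inr_inl] at hxy
    have hj : j = Fin.rev i' := by by_contra h; exact hxy (if_neg h)
    subst hj
    change (Finset.univ \ S).card + ((Finset.univ \ S).filter fun α => (Fin.rev α).val ≤ (Fin.rev i').val).card +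
      ((Finset.univ \ S).filter fun α => α.val < i'.val).card = _
    have h := hcompl i'
    omega
  · exact absurd (wittForm_inr_inr_inr_inl r Han j u') hxy
  · exact absurd (wittForm_inr_inr_inr_inr r Han j j') hxy

/-- The **block labelling of the standard parabolic `P_S`** with values in the finite linear order `Fin (2L+1)`, `L = #{α ∉ S}` (so that ★
`standardLeviGL` ∕ `parabolicTripleGL`, which assemble block-diagonal matrices over a `Fintype` of labels, apply, and `Fin.rev` is the mirror).
[cite: Borel1991, §23] -/
def wittBlock (S : Finset (Fin r)) (x : WittIndex r m) : Fin (2 * (Finset.univ \ S).card + 1) :=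
  ⟨wittBlockNat S x, Nat.lt_succ_of_le (wittBlockNat_le S x)⟩

/-- `(wittBlock S x).val = wittBlockNat S x` (`rfl`). [cite: Borel1991, §23] -/
@[simp] theorem wittBlock_val (S : Finset (Fin r)) (x : WittIndex r m) : (wittBlock S x).val = wittBlockNat S x := rfl

/-- `S = univ`: `wittBlock univ` is the constant labelling `0`. [cite: Borel1991, §23] -/
@[simp] theorem wittBlock_univ (x : WittIndex r m) : wittBlock (Finset.univ : Finset (Fin r)) x = 0 :=
  Fin.ext (wittBlockNat_univ x)

/-- **The Witt form is ANTI-BLOCK for `wittBlock S` and the mirror `Fin.rev`**: `W(r, Han)_{xy} ≠ 0 → label(y) = rev (label(x))` — the docking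
hypothesis `hJ` of ★ `K2E3UnitaryParabolicLeviPart` (`τ = Fin.rev`, antitone and injective), for every `S`. [cite: Borel1991, §23] -/
theorem wittBlock_eq_rev_of_wittForm_ne_zero {R : Type*} [Zero R] [One R] (S : Finset (Fin r)) (Han : Matrix (Fin m) (Fin m) R)
    {x y : WittIndex r m} (hxy : wittForm r Han x y ≠ 0) : wittBlock S y = Fin.rev (wittBlock S x) := by
  apply Fin.ext
  rw [Fin.val_rev, wittBlock_val, wittBlock_val]
  have h := wittBlockNat_add_eq_of_wittForm_ne_zero S Han hxy
  omega

/-- The labelling transported to a carrier `n` along `e : WittIndex r m ≃ n`: `k ↦ wittBlock S (e⁻¹ k)`. [cite: Borel1991, §23] -/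
def wittBlockOn {n : Type*} (e : WittIndex r m ≃ n) (S : Finset (Fin r)) (k : n) : Fin (2 * (Finset.univ \ S).card + 1) :=
  wittBlock S (e.symm k)

/-- `wittBlockOn e S k = wittBlock S (e.symm k)` (`rfl`). [cite: Borel1991, §23] -/
@[simp] theorem wittBlockOn_apply {n : Type*} (e : WittIndex r m ≃ n) (S : Finset (Fin r)) (k : n) :
    wittBlockOn e S k = wittBlock S (e.symm k) := rfl

/-- **`wittFormOn e Han` is anti-block for `wittBlockOn e S` and `Fin.rev`** (transport of `wittBlock_eq_rev_of_wittForm_ne_zero`): verbatim the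
hypothesis `hJ : ∀ k l, J k l ≠ 0 → c l = τ (c k)` of ★ `K2E3UnitaryParabolicLeviPart` with `J = wittFormOn e Han`, `c = wittBlockOn e S`, `τ = Fin.rev`.
[cite: Borel1991, §23] -/
theorem wittBlockOn_eq_rev_of_wittFormOn_ne_zero {R : Type*} [Zero R] [One R] {n : Type*} (e : WittIndex r m ≃ n) (S : Finset (Fin r))
    (Han : Matrix (Fin m) (Fin m) R) (k l : n) (hkl : wittFormOn e Han k l ≠ 0) : wittBlockOn e S l = Fin.rev (wittBlockOn e S k) :=
  wittBlock_eq_rev_of_wittForm_ne_zero S Han hkl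

end Blocks

/-! ## §2 Standard parabolics, Levi subgroups and radicals of `U(σ, J)` in a Witt frame -/

section Parabolics

variable {R : Type*} [CommRing R] (σ : R →+* R) {n : Type*} [Fintype n] [DecidableEq n] (J : Matrix n n R) {r m : ℕ}
  (e : WittIndex r m ≃ n) (S : Finset (Fin r))

/-- The **standard parabolic `P_S ≤ U(σ, J)`**: elements of `U` block upper triangular for the labelling `wittBlock S ∘ e⁻¹` (pull-back of ★
`standardParabolicGL`).  For `J = wittFormOn e Han` this is the stabiliser of the isotropic flag members at the breaks of `S`; `S = univ` gives `U`,
`S = ∅` the minimal parabolic. [cite: Borel1991, §23] [cite: BernsteinZelevinsky1977, §2.1] -/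
def wittParabolic : Subgroup ↥(unitaryGroupOfForm σ J) :=
  (standardParabolicGL R (wittBlockOn e S)).comap (unitaryGroupOfForm σ J).subtype

/-- The **standard Levi subgroup `M_S ≤ U(σ, J)`**: elements of `U` block diagonal for `wittBlock S ∘ e⁻¹` (pull-back of ★ `standardLeviGL`); for
`J = wittFormOn e Han`, `M_S ≅ ∏ GL(blocks of e) × U(middle block)`. [cite: Borel1991, §23] [cite: BernsteinZelevinsky1977, §2.1] -/
def wittLevi : Subgroup ↥(unitaryGroupOfForm σ J) :=
  (standardLeviGL R (wittBlockOn e S)).comap (unitaryGroupOfForm σ J).subtype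

/-- The **radical `N_S ≤ U(σ, J)`** of `P_S`: elements of `U` block upper triangular with identity diagonal blocks (pull-back of ★ `unipotentRadicalGL`).
[cite: Borel1991, §23] [cite: BernsteinZelevinsky1977, §2.1] -/
def wittRadical : Subgroup ↥(unitaryGroupOfForm σ J) :=
  (unipotentRadicalGL R (wittBlockOn e S)).comap (unitaryGroupOfForm σ J).subtype

/-- The **opposite radical `N_S⁻ ≤ U(σ, J)`**: elements of `U` block LOWER triangular with identity diagonal blocks (★ `unipotentRadicalGL` for the
order-dual labelling `toDual ∘ wittBlock S ∘ e⁻¹`). [cite: Borel1991, §23] [cite: BernsteinZelevinsky1977, §2.1] -/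
def wittOppRadical : Subgroup ↥(unitaryGroupOfForm σ J) :=
  (unipotentRadicalGL R (OrderDual.toDual ∘ wittBlockOn e S)).comap (unitaryGroupOfForm σ J).subtype

variable {σ J e S}

/-- Membership in `P_S`: the underlying matrix is block triangular for `wittBlock S ∘ e⁻¹`. [cite: BernsteinZelevinsky1977, §2.1] -/
theorem mem_wittParabolic_iff (g : ↥(unitaryGroupOfForm σ J)) :
    g ∈ wittParabolic σ J e S ↔ ((g : GL n R) : Matrix n n R).BlockTriangular (wittBlockOn e S) := Iff.rfl

/-- Membership in `M_S`: the underlying element of `GL_n(R)` lies in ★ `standardLeviGL R (wittBlock S ∘ e⁻¹)`. [cite: BernsteinZelevinsky1977, §2.1] -/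
theorem mem_wittLevi_iff (g : ↥(unitaryGroupOfForm σ J)) :
    g ∈ wittLevi σ J e S ↔ (g : GL n R) ∈ standardLeviGL R (wittBlockOn e S) := Iff.rfl

/-- Membership in `N_S`: the underlying element lies in ★ `unipotentRadicalGL R (wittBlock S ∘ e⁻¹)` (block triangular, identity diagonal blocks:
★ `mem_unipotentRadicalGL_iff`). [cite: BernsteinZelevinsky1977, §2.1] -/
theorem mem_wittRadical_iff (g : ↥(unitaryGroupOfForm σ J)) :
    g ∈ wittRadical σ J e S ↔ (g : GL n R) ∈ unipotentRadicalGL R (wittBlockOn e S) := Iff.rfl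

/-- Membership in `N_S⁻`: the underlying element lies in ★ `unipotentRadicalGL` for the order-dual labelling. [cite: BernsteinZelevinsky1977, §2.1] -/
theorem mem_wittOppRadical_iff (g : ↥(unitaryGroupOfForm σ J)) :
    g ∈ wittOppRadical σ J e S ↔ (g : GL n R) ∈ unipotentRadicalGL R (OrderDual.toDual ∘ wittBlockOn e S) := Iff.rfl

variable (σ J e S)

/-- `M_S ≤ P_S` (★ `standardLeviGL_le`, pulled back). [cite: BernsteinZelevinsky1977, §2.1] -/
theorem wittLevi_le_wittParabolic : wittLevi σ J e S ≤ wittParabolic σ J e S :=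
  Subgroup.comap_mono (standardLeviGL_le R (wittBlockOn e S))

/-- `N_S ≤ P_S` (★ `unipotentRadicalGL_le`, pulled back). [cite: BernsteinZelevinsky1977, §2.1] -/
theorem wittRadical_le_wittParabolic : wittRadical σ J e S ≤ wittParabolic σ J e S :=
  Subgroup.comap_mono (unipotentRadicalGL_le R (wittBlockOn e S))

/-- **`P_S` normalises `N_S`** (★ `parabolicTripleGL.le_normalizer`, pulled back along `U.subtype`). [cite: BernsteinZelevinsky1977, §2.1] -/
theorem wittParabolic_le_normalizer :
    wittParabolic σ J e S ≤ Subgroup.normalizer (wittRadical σ J e S : Set ↥(unitaryGroupOfForm σ J)) :=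
  (Subgroup.comap_mono (f := (unitaryGroupOfForm σ J).subtype)
    (parabolicTripleGL R (wittBlockOn e S)).le_normalizer).trans (Subgroup.le_normalizer_comap _)

/-- **`P_univ = U`**: with every simple root in the Levi there is one block and no triangularity condition. [cite: Borel1991, §23] -/
theorem wittParabolic_univ : wittParabolic σ J e (Finset.univ : Finset (Fin r)) = ⊤ := by
  refine eq_top_iff.2 fun g _ => ?_
  rw [mem_wittParabolic_iff]
  intro i j hij
  exact absurd hij (by simp [wittBlockOn_apply])

end Parabolics

/-! ## §3 The standard parabolic TRIPLE `(P_S, M_S, N_S)` of `U(σ, W(r, Han))` (assembly over ★ `K2E3UnitaryParabolicLeviPart`) -/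

section Triple

variable {R : Type*} [CommRing R] (σ : R →+* R) {n : Type*} [Fintype n] [DecidableEq n] {r m : ℕ}
  (e : WittIndex r m ≃ n) (Han : Matrix (Fin m) (Fin m) R) (S : Finset (Fin r))

/-- **The standard parabolic triple `(P_S, M_S, N_S)` of the unitary group `U(σ, W(r, Han))` of a Witt normal form**, as the tree's ★ `ParabolicTriple`
(the input of ★ `Representation.jacquetModule` ∕ `normalizedInd` ∕ Jacquet's lemma): `P = wittParabolic`, `M = wittLevi`, `N = wittRadical`; the proof fields
are ★ K2E3-p10's `le_normalizer_parabolic_unitary` and `isComplement'_levi_unipotent_unitary` (`P_S ∩ U = (M_S ∩ U) ⋉ (N_S ∩ U)`: the Levi part of a unitary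
block-triangular matrix is unitary for an ANTI-BLOCK form), fed with the mirror `τ = Fin.rev` and `wittBlockOn_eq_rev_of_wittFormOn_ne_zero`.  `S = ∅` is the
minimal parabolic, `S = univ.erase α` the maximal parabolic of the simple root `α`. [cite: Borel1991, §23] [cite: BernsteinZelevinsky1977, §2.1] -/
noncomputable def standardParabolicTriple : ParabolicTriple ↥(unitaryGroupOfForm σ (wittFormOn e Han)) where
  P := wittParabolic σ (wittFormOn e Han) e S
  M := wittLevi σ (wittFormOn e Han) e S
  N := wittRadical σ (wittFormOn e Han) e S
  M_le := wittLevi_le_wittParabolic σ (wittFormOn e Han) e S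
  N_le := wittRadical_le_wittParabolic σ (wittFormOn e Han) e S
  le_normalizer := wittParabolic_le_normalizer σ (wittFormOn e Han) e S
  isComplement' :=
    K2E3UnitaryParabolicLeviPart.isComplement'_levi_unipotent_unitary σ (wittBlockOn e S) Fin.rev
      (fun _ _ h => Fin.rev_le_rev.2 h) Fin.rev_injective (wittFormOn e Han)
      (fun k l h => wittBlockOn_eq_rev_of_wittFormOn_ne_zero e S Han k l h)

/-- The parabolic of `standardParabolicTriple` is `P_S = wittParabolic` (`rfl`). [cite: BernsteinZelevinsky1977, §2.1] -/
@[simp] theorem standardParabolicTriple_P : (standardParabolicTriple σ e Han S).P = wittParabolic σ (wittFormOn e Han) e S := rfl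

/-- The Levi of `standardParabolicTriple` is `M_S = wittLevi` (`rfl`). [cite: BernsteinZelevinsky1977, §2.1] -/
@[simp] theorem standardParabolicTriple_M : (standardParabolicTriple σ e Han S).M = wittLevi σ (wittFormOn e Han) e S := rfl

/-- The radical of `standardParabolicTriple` is `N_S = wittRadical` (`rfl`). [cite: BernsteinZelevinsky1977, §2.1] -/
@[simp] theorem standardParabolicTriple_N : (standardParabolicTriple σ e Han S).N = wittRadical σ (wittFormOn e Han) e S := rfl

/-- **`P_univ` is the whole group**: the triple of `S = univ` has `P = ⊤` (`wittParabolic_univ`). [cite: Borel1991, §23] -/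
theorem standardParabolicTriple_univ_P : (standardParabolicTriple σ e Han (Finset.univ : Finset (Fin r))).P = ⊤ :=
  wittParabolic_univ σ (wittFormOn e Han) e

end Triple

end Summit.HodgeConjecture.HodgeConjecture.Cruxes.H413.K2E3LocalUnitaryWitt
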